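import Literature.NumberTheory.GaloisRepresentations.ContinuousCorestriction
import Literature.NumberTheory.GaloisRepresentations.GaloisCohomologyKummerProofs
import HarnessLib

/-!
# `cor ∘ Kummer = Kummer ∘ Norm` at the COCYCLE level: the transfer of a Kummer cocycle `h ↦ hβ/β` is the Kummer cocycle of the
# norm element `∏ₓ s(x)·β`

Topic `NumberTheory/GaloisRepresentations`; namespace `Literature.NumberTheory.GaloisRepresentations`.  THEOREMS ONLY (no definition, no
named fact, no `sorry`, no instance).

The tree's degree-one corestriction along an open subgroup `N ≤ G` of finite index is the explicit TRANSFER on continuous crossed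
homomorphisms, `(cor f)(g) = Σ_{x ∈ G/N} s(g·x) · f(s(g·x)⁻¹ g s(x))` (`transferFun`, `transferCocycle`, `cores_oneCocycleClass`,
`ContinuousCorestriction.lean`).  A KUMMER cocycle on `N` — `h ↦ h·β − β` for an element `β` of the AMBIENT `G`-module (written additively;
multiplicatively `hβ/β`, `βⁿ = b` fixed by `N`) — is the restriction to `N` of a coboundary of `G`, and its transfer is computed on the nose:

* §1 (any topological group `G`, any topological representation `X`) **`transferFun_eq_of_forall_eq_sub`**: if `f(h) = h·β − β` on `N` then
  `(cor f)(g) = g·α − α` with **`α = Σ_{x ∈ G/N} s(x)·β`** (the «norm element» of `β` for the representatives `s`) — reindex `x ↦ g·x`;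
  `transferFun_congr_of_hom` — the transfer commutes with any additive `G`-equivariant coefficient map (naturality in the coefficients).
* §2 (`G = Γ_k`, `X = μₙ(k̄)` = the tree's `DiscreteGaloisModule.mu k n`, values read in `k̄ˣ` through `muVal`)
  **`muVal_transferFun_of_kummer`**: for a `μₙ`-valued cocycle `f` on `N` with `f(h) = hβ/β` in `k̄ˣ`,
  `(cor f)(g) = gα/α` with `α = ∏_{x ∈ Γ_k/N} s(x)·β`, and `αⁿ = ∏_{x} s(x)·βⁿ` (`prod_smul_pow`); hence
  **`cores_oneCocycleClass_of_kummer`**: `cor [f] = [φ]` for ANY cocycle `φ` of `Γ_k` with `φ(g) = gα/α`.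

So «`Cor_{F'/F} ∘ κ_{F'} = κ_F ∘ N_{F'/F}` on `F'ˣ/(F'ˣ)ⁿ → H¹(F, μₙ)`» (Neukirch–Schmidt–Wingberg (1.5.x)/VII; Serre, *Local Fields* X §3 with VII §8):
the norm here is the product over coset representatives `∏ₓ s(x)·b` (its identification with the field norm `N_{F'/F} b` for `N = Gal(k̄/F')`,
`G ⊇ Gal(k̄/F)` is the Galois-theoretic bookkeeping «cosets of `Gal(k̄/F')` in `Gal(k̄/F)` = `F`-embeddings of `F'`», left to the consumer's
currency).  Consumer: (α3) ROW 2 of cell `bsd-print-cf2` (the units-side lift `…Theorems/PrintCf2RubinValueTwoRowTwoUnitsLift`, hypothesis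
`hredn` «`kum` sends `N_{F_{n+1}/F_n}` to `cores`») and the F0 construction of the JLK carriers (consistency of the `aZeta` pin across levels).
HONEST FRAMING: classical cohomological bookkeeping; nothing about BSD.

References: J. Neukirch, A. Schmidt, K. Wingberg, *Cohomology of Number Fields* (2008) I §5 (corestriction on inhomogeneous cochains; `cor` in
degree `0` is the norm); J.-P. Serre, *Local Fields* (1979) VII §7–§8, X §3 b).
-/

noncomputable section

open CategoryTheory Function

universe u v

namespace Literature.NumberTheory.GaloisRepresentations

open Literature.NumberTheory.EllipticCurves (schreierElt schreierElt_coe)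
open _root_.ContinuousCohomology

/-! ## §1. The transfer of a restricted coboundary is the coboundary of the norm element -/

section Generic

variable {R : Type u} [Ring R] [TopologicalSpace R]
variable {G : Type v} [Group G] [TopologicalSpace G] [IsTopologicalGroup G]
variable (X : TopRep.{v} R G) (N : Subgroup G) [Fintype (G ⧸ N)] {s : G ⧸ N → G}

omit [IsTopologicalGroup G] in
/-- **`cor(∂β|_N) = ∂(Σₓ s(x)·β)` on the nose.** If the crossed homomorphism `f` on `N` is `h ↦ h·β − β` for some `β ∈ X`, then its transfer is
`g ↦ g·α − α` with `α = Σ_{x ∈ G/N} s(x)·β`. [cite: NeukirchSchmidtWingberg2008, Ch. I §5 (corestriction on inhomogeneous cochains)] -/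
theorem transferFun_eq_of_forall_eq_sub (hs : ∀ x : G ⧸ N, (s x : G ⧸ N) = x) (f : contOneCocycles (subgroupRep X N)) (β : X)
    (hf : ∀ h : N, f.1 h = X.ρ (h : G) β - β) (g : G) :
    transferFun X N hs f g = X.ρ g (∑ x : G ⧸ N, X.ρ (s x) β) - ∑ x : G ⧸ N, X.ρ (s x) β := by
  rw [transferFun_apply]
  have key : ∀ x : G ⧸ N, X.ρ (s (g • x)) (f.1 (schreierElt N hs g x)) = X.ρ g (X.ρ (s x) β) - X.ρ (s (g • x)) β := by
    intro x
    rw [hf, map_sub, schreierElt_coe, ← ρ_mul_apply, ← ρ_mul_apply, mul_assoc, mul_inv_cancel_left]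
  rw [Finset.sum_congr rfl fun x _ ↦ key x, Finset.sum_sub_distrib, map_sum]
  congr 1
  exact Equiv.sum_comp (MulAction.toPerm g) (fun y ↦ X.ρ (s y) β)

omit [IsTopologicalGroup G] in
/-- **Naturality of the transfer in the coefficients**: for an additive `G`-equivariant `φ : Y → X` and cocycles `f` on `N` in `Y`, `f'` in `X` with
`f' = φ ∘ f`, the transfers satisfy `cor f' = φ ∘ cor f` (as functions on `G`). [cite: NeukirchSchmidtWingberg2008, Ch. I §5 (1.5.2)] -/
theorem transferFun_congr_of_hom (hs : ∀ x : G ⧸ N, (s x : G ⧸ N) = x) (Y : TopRep.{v} R G) (φ : Y →+ X)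
    (hφ : ∀ (g : G) (y : Y), φ (Y.ρ g y) = X.ρ g (φ y)) (f : contOneCocycles (subgroupRep Y N)) (f' : contOneCocycles (subgroupRep X N))
    (hff' : ∀ h : N, f'.1 h = φ (f.1 h)) (g : G) : transferFun X N hs f' g = φ (transferFun Y N hs f g) := by
  rw [transferFun_apply, transferFun_apply, map_sum]
  exact Finset.sum_congr rfl fun x _ ↦ by rw [hff', hφ]

end Generic

/-! ## §2. `μₙ`-valued Kummer cocycles of `Γ_k`: `cor (hβ/β) = gα/α`, `α = ∏ₓ s(x)·β` -/

section Kummer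

open DiscreteGaloisModule

variable (k : Type u) [Field k] (n : ℕ) (N : Subgroup (Field.absoluteGaloisGroup k)) [Fintype (Field.absoluteGaloisGroup k ⧸ N)]
  {s : Field.absoluteGaloisGroup k ⧸ N → Field.absoluteGaloisGroup k}

/-- `muVal` of a finite sum is the product of the `muVal`s. [folklore] -/
private theorem muVal_sum {ι : Type*} (t : Finset ι) (v : ι → MuCarrier k n) :
    muVal k n (∑ i ∈ t, v i) = ∏ i ∈ t, muVal k n (v i) := by
  classical
  induction t using Finset.induction_on with
  | empty => simp
  | insert a t ha ih => rw [Finset.sum_insert ha, Finset.prod_insert ha, muVal_add, ih]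

/-- **`cor (hβ/β) = gα/α` with `α = ∏ₓ s(x)·β`, read in `k̄ˣ`.** For a `μₙ`-valued continuous cocycle `f` of the open finite-index subgroup
`N ≤ Γ_k` whose values are `hβ/β` (`β ∈ k̄ˣ`, so `βⁿ` is `N`-fixed), the transfer cocycle takes the value `gα/α` at `g ∈ Γ_k`, where
`α = ∏_{x ∈ Γ_k/N} s(x)·β`. [cite: NeukirchSchmidtWingberg2008, Ch. I §5] [cite: Serre1979, Ch. X §3 b)] -/
theorem muVal_transferFun_of_kummer (hs : ∀ x : Field.absoluteGaloisGroup k ⧸ N, (s x : Field.absoluteGaloisGroup k ⧸ N) = x)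
    (f : contOneCocycles (subgroupRep (mu k n).toTopRep N)) (β : (AlgebraicClosure k)ˣ)
    (hf : ∀ h : N, muVal k n (f.1 h) = (h : Field.absoluteGaloisGroup k) • β / β) (g : Field.absoluteGaloisGroup k) :
    muVal k n (transferFun (mu k n).toTopRep N hs f g) =
      g • (∏ x : Field.absoluteGaloisGroup k ⧸ N, s x • β) / ∏ x : Field.absoluteGaloisGroup k ⧸ N, s x • β := by
  rw [transferFun_apply, muVal_sum]
  have key : ∀ x : Field.absoluteGaloisGroup k ⧸ N,
      muVal k n ((mu k n).toTopRep.ρ (s (g • x)) (f.1 (schreierElt N hs g x))) = g • (s x • β) / (s (g • x) • β) := by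
    intro x
    change muVal k n ((mu k n).toContRepresentation (s (g • x)) (f.1 (schreierElt N hs g x))) = _
    rw [muVal_toContRepresentation_apply, hf, schreierElt_coe, smul_div', ← mul_smul, ← mul_smul, mul_assoc,
      mul_inv_cancel_left]
  rw [Finset.prod_congr rfl fun x _ ↦ key x, Finset.prod_div_distrib, Finset.smul_prod']
  congr 1
  exact Equiv.prod_comp (MulAction.toPerm g) (fun y ↦ s y • β)

/-- `(∏ₓ s(x)·β)ⁿ = ∏ₓ s(x)·βⁿ` — the `n`-th power of the norm element of `β` is the norm element of `b = βⁿ` (the element whose `n`-th root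
gives the corestricted Kummer class). [cite: NeukirchSchmidtWingberg2008, Ch. I §5 (cor in degree 0 is the norm)] [cite: Serre1979, Ch. X §3 b)] -/
theorem prod_smul_pow (β : (AlgebraicClosure k)ˣ) :
    (∏ x : Field.absoluteGaloisGroup k ⧸ N, s x • β) ^ n = ∏ x : Field.absoluteGaloisGroup k ⧸ N, s x • β ^ n := by
  rw [← Finset.prod_pow]
  exact Finset.prod_congr rfl fun x _ ↦ (smul_pow' (s x) β n).symm

/-- **`cor [hβ/β] = [gα/α]` in `H¹(Γ_k, μₙ)`**: the corestriction of the class of a `μₙ`-valued Kummer cocycle of `β` on `N` is the class of ANY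
cocycle `φ` of `Γ_k` with values `gα/α`, `α = ∏ₓ s(x)·β` (e.g. the tree's `kummerOneCocycle k n α` when `αⁿ ∈ k`).
[cite: NeukirchSchmidtWingberg2008, Ch. I §5] [cite: Serre1979, Ch. X §3 b)] -/
theorem cores_oneCocycleClass_of_kummer (hN : IsOpen (N : Set (Field.absoluteGaloisGroup k)))
    (hs : ∀ x : Field.absoluteGaloisGroup k ⧸ N, (s x : Field.absoluteGaloisGroup k ⧸ N) = x)
    (f : contOneCocycles (subgroupRep (mu k n).toTopRep N)) (β : (AlgebraicClosure k)ˣ)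
    (hf : ∀ h : N, muVal k n (f.1 h) = (h : Field.absoluteGaloisGroup k) • β / β) (φ : contOneCocycles (mu k n).toTopRep)
    (hφ : ∀ g : Field.absoluteGaloisGroup k, muVal k n (φ.1 g) =
      g • (∏ x : Field.absoluteGaloisGroup k ⧸ N, s x • β) / ∏ x : Field.absoluteGaloisGroup k ⧸ N, s x • β) :
    cores (mu k n).toTopRep N hN (oneCocycleClass _ f) = oneCocycleClass (mu k n).toTopRep φ := by
  rw [cores_oneCocycleClass _ _ hN hs]
  congr 1
  refine Subtype.ext (ContinuousMap.ext fun g ↦ muVal_injective k n ?_)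
  rw [transferCocycle_apply, muVal_transferFun_of_kummer k n N hs f β hf g, hφ]

end Kummer

end Literature.NumberTheory.GaloisRepresentations

end
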